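import Summits.RiemannHypothesis.RiemannHypothesis.Theorems.PfPersistenceCoefficientRigiditySymbol
import Summits.RiemannHypothesis.RiemannHypothesis.Theorems.PfPersistenceCoefficientRigiditySummable
import HarnessLib

/-!
# Coefficient rigidity of window positivity, IX-a: the symbol of an `ℓ¹` table perturbation —
preliminaries
(pub-rhpf cand-7, gen 9; mechanism/rigidity campaign; no RH claims)

Ninth part of `PfPersistenceCoefficientRigidity`, first half: the analytic preliminaries for the
`ℓ¹` SYMBOL CRITERION (part IX-b).  For an absolutely summable coefficient sequence `c : ℕ → ℝ`
(think `c(n) = Λ(n)/√n - w(n)`, the defect of a weight table `w`) the SYMBOL is the absolutely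
convergent cosine series `P(t) = ∑_n c(n) cos(t log n)` (entries `n = 0, 1` sit at the origin).

* `tableSymbol`, `absTail`; continuity, the bound `|P| ≤ ∑|c|`, truncation
  `|P(t) - P_M(t)| ≤ ∑_{n ≥ M} |c(n)|`, tails `→ 0`.
* `tableDatum_quadratic_eq_multiSite_range` — on a window, `Q_w(g)` IS the multi-site functional
  of part IV-b with sites `log n`, `n ≤ N` (no condition at `n = 0, 1`).
* `table_re_le`, `riemannHypothesis_of_table_lower_bound` **(RH-free)**.
* `siteSum_range_wavePacket_le` — the wave-packet site-sum estimate with a general symbol level.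
* `table_re_ge` — **(RH-free)** the Plancherel lower bound
  `Re W(g ⋆ g̃) + 2 (inf P) ‖g‖₂² ≤ Re Q_w(g)` for every test function `g`.

ALL STATEMENTS ARE PROVED (no `sorry`, no new axioms); no sentence is DATA.

References: E. Bombieri, Rend. Lincei (9) 11 (2000) 183–233, Thm. 1, §2.
-/

set_option linter.dupNamespace false

noncomputable section

open Complex Filter Set MeasureTheory
open scoped Real Topology ComplexConjugate NNReal

namespace Summit.RiemannHypothesis.RiemannHypothesis.Theorems.PfPersistenceCoefficientRigidity

open Literature.NumberTheory.LFunctions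
open Literature.NumberTheory.LFunctions.WeilConverse
open Summit.RiemannHypothesis.RiemannHypothesis.Theorems.PfPersistenceDownCone
open Summit.RiemannHypothesis.RiemannHypothesis.Theorems.PfPersistenceBarrier

/-! ## §47 The symbol of an `ℓ¹` sequence of table coefficients -/

/-- The SYMBOL of a coefficient sequence `c` on the table sites `log n`:
`P(t) = ∑_n c(n) cos(t log n)`. [this work] -/
def tableSymbol (c : ℕ → ℝ) (t : ℝ) : ℝ := ∑' n : ℕ, c n * Real.cos (t * Real.log (n : ℝ))

/-- The absolute tail `∑_{k} |c(k + M)|`. [this work] -/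
def absTail (c : ℕ → ℝ) (M : ℕ) : ℝ := ∑' k : ℕ, |c (k + M)|

/-- `|c(n) cos(t log n)| ≤ |c(n)|`. [folklore] -/
theorem abs_mul_cos_log_le (c : ℕ → ℝ) (t : ℝ) (n : ℕ) :
    |c n * Real.cos (t * Real.log (n : ℝ))| ≤ |c n| := by
  rw [abs_mul]
  exact mul_le_of_le_one_right (abs_nonneg _) (Real.abs_cos_le_one _)

/-- The symbol series converges absolutely. [this work] -/
theorem summable_abs_mul_cos_log {c : ℕ → ℝ} (hsum : Summable fun n ↦ |c n|) (t : ℝ) :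
    Summable fun n : ℕ ↦ |c n * Real.cos (t * Real.log (n : ℝ))| :=
  Summable.of_nonneg_of_le (fun _ ↦ abs_nonneg _) (abs_mul_cos_log_le c t) hsum

/-- The symbol series converges. [this work] -/
theorem summable_mul_cos_log {c : ℕ → ℝ} (hsum : Summable fun n ↦ |c n|) (t : ℝ) :
    Summable fun n : ℕ ↦ c n * Real.cos (t * Real.log (n : ℝ)) :=
  (summable_abs_mul_cos_log hsum t).of_abs

/-- `|∑' f| ≤ ∑' |f|` for an absolutely summable real sequence. [folklore] -/
theorem abs_tsum_le_tsum_abs {f : ℕ → ℝ} (hf : Summable fun n ↦ |f n|) :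
    |∑' n, f n| ≤ ∑' n, |f n| := by
  have h := norm_tsum_le_tsum_norm (f := f) (by simpa only [Real.norm_eq_abs] using hf)
  simpa only [Real.norm_eq_abs] using h

/-- `|P(t)| ≤ ∑ |c(n)|`. [this work] -/
theorem abs_tableSymbol_le {c : ℕ → ℝ} (hsum : Summable fun n ↦ |c n|) (t : ℝ) :
    |tableSymbol c t| ≤ ∑' n, |c n| :=
  (abs_tsum_le_tsum_abs (summable_abs_mul_cos_log hsum t)).trans
    (Summable.tsum_le_tsum (abs_mul_cos_log_le c t) (summable_abs_mul_cos_log hsum t) hsum)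

/-- `P` is continuous (uniformly convergent series). [this work] -/
theorem continuous_tableSymbol {c : ℕ → ℝ} (hsum : Summable fun n ↦ |c n|) :
    Continuous (tableSymbol c) :=
  continuous_tsum (fun n ↦ by fun_prop) hsum fun n t ↦ by
    rw [Real.norm_eq_abs]
    exact abs_mul_cos_log_le c t n

/-- `P` is bounded below. [this work] -/
theorem bddBelow_range_tableSymbol {c : ℕ → ℝ} (hsum : Summable fun n ↦ |c n|) :
    BddBelow (Set.range (tableSymbol c)) := by
  refine ⟨-∑' n, |c n|, ?_⟩
  rintro _ ⟨t, rfl⟩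
  have h1 := neg_abs_le (tableSymbol c t)
  have h2 := abs_tableSymbol_le hsum t
  linarith

/-- `inf P ≤ P(t)`. [this work] -/
theorem ciInf_tableSymbol_le {c : ℕ → ℝ} (hsum : Summable fun n ↦ |c n|) (t : ℝ) :
    (⨅ s, tableSymbol c s) ≤ tableSymbol c t :=
  ciInf_le (bddBelow_range_tableSymbol hsum) t

/-- Truncation: `P(t) = P_M(t) + ∑_k c(k+M) cos(t log(k+M))` with `P_M` the symbol of the finitely
many sites `n < M` (part VIII-a's `siteSymbol`). [this work] -/
theorem tableSymbol_eq_siteSymbol_add_tsum {c : ℕ → ℝ} (hsum : Summable fun n ↦ |c n|) (M : ℕ)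
    (t : ℝ) :
    tableSymbol c t = siteSymbol (Finset.range M) c (fun n : ℕ ↦ Real.log (n : ℝ)) t +
      ∑' k : ℕ, c (k + M) * Real.cos (t * Real.log ((k + M : ℕ) : ℝ)) := by
  rw [tableSymbol, siteSymbol, ← Summable.sum_add_tsum_nat_add M (summable_mul_cos_log hsum t)]

/-- The shifted absolute sequence is summable. [folklore] -/
theorem summable_abs_shift {c : ℕ → ℝ} (hsum : Summable fun n ↦ |c n|) (M : ℕ) :
    Summable fun k : ℕ ↦ |c (k + M)| :=
  (summable_nat_add_iff (f := fun n ↦ |c n|) M).2 hsum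

/-- `0 ≤ absTail`. [this work] -/
theorem absTail_nonneg (c : ℕ → ℝ) (M : ℕ) : 0 ≤ absTail c M :=
  tsum_nonneg fun _ ↦ abs_nonneg _

/-- **Truncation error**: `|P(t) - P_M(t)| ≤ ∑_{k} |c(k + M)|`. [this work] -/
theorem abs_tableSymbol_sub_siteSymbol_le {c : ℕ → ℝ} (hsum : Summable fun n ↦ |c n|) (M : ℕ)
    (t : ℝ) :
    |tableSymbol c t - siteSymbol (Finset.range M) c (fun n : ℕ ↦ Real.log (n : ℝ)) t| ≤
      absTail c M := by
  rw [tableSymbol_eq_siteSymbol_add_tsum hsum M t, add_sub_cancel_left, absTail]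
  have hb : ∀ k : ℕ, |c (k + M) * Real.cos (t * Real.log ((k + M : ℕ) : ℝ))| ≤ |c (k + M)| :=
    fun k ↦ by
      rw [abs_mul]
      exact mul_le_of_le_one_right (abs_nonneg _) (Real.abs_cos_le_one _)
  have hs : Summable fun k : ℕ ↦ |c (k + M) * Real.cos (t * Real.log ((k + M : ℕ) : ℝ))| :=
    Summable.of_nonneg_of_le (fun _ ↦ abs_nonneg _) hb (summable_abs_shift hsum M)
  exact (abs_tsum_le_tsum_abs hs).trans (Summable.tsum_le_tsum hb hs (summable_abs_shift hsum M))

/-- The tails tend to `0`. [this work] -/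
theorem tendsto_absTail (c : ℕ → ℝ) : Tendsto (absTail c) atTop (𝓝 0) :=
  tendsto_sum_nat_add fun n ↦ |c n|

/-- Eventually the tails are small: `∃ N₁ ≥ 1, ∀ M ≥ N₁, absTail c M < η`. [this work] -/
theorem exists_absTail_lt (c : ℕ → ℝ) {η : ℝ} (hη : 0 < η) :
    ∃ N₁ : ℕ, 1 ≤ N₁ ∧ ∀ M, N₁ ≤ M → absTail c M < η := by
  obtain ⟨N, hN⟩ := eventually_atTop.1 ((tendsto_order.1 (tendsto_absTail c)).2 η hη)
  exact ⟨max N 1, le_max_right _ _, fun M hM ↦ hN M ((le_max_left _ _).trans hM)⟩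

/-- A block of absolute values is bounded by the tail: `∑_{a ≤ n < b} |c(n)| ≤ absTail c a`.
[this work] -/
theorem sum_Ico_abs_le_absTail {c : ℕ → ℝ} (hsum : Summable fun n ↦ |c n|) (a b : ℕ) :
    ∑ n ∈ Finset.Ico a b, |c n| ≤ absTail c a := by
  rw [Finset.sum_Ico_eq_sum_range]
  calc ∑ k ∈ Finset.range (b - a), |c (a + k)| = ∑ k ∈ Finset.range (b - a), |c (k + a)| :=
        Finset.sum_congr rfl fun k _ ↦ by rw [add_comm]
    _ ≤ absTail c a :=
        (summable_abs_shift hsum a).sum_le_tsum _ fun _ _ ↦ abs_nonneg _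

/-! ## §48 Tables on a window are multi-site functionals -/

/-- On a window `[-½log(N+1), ½log(N+1)] ⊇ supp g`:
`Q_w(g) = Q_{E,c,x}(g)` with `E = {0, …, N}`, `c(n) = Λ(n)/√n - w(n)`, `x(n) = log n`.
[this work] -/
theorem tableDatum_quadratic_eq_multiSite_range (w : ℕ → ℝ) {g : ℝ → ℂ} (hg : IsWeilTest g)
    {N : ℕ}
    (hsupp : tsupport g ⊆ Icc (-(Real.log ((N : ℝ) + 1) / 2)) (Real.log ((N : ℝ) + 1) / 2)) :
    (tableDatum w).quadratic g =
      multiSiteQuadratic (Finset.range (N + 1)) (fun n ↦ zetaTable n - w n)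
        (fun n : ℕ ↦ Real.log (n : ℝ)) g := by
  rw [tableDatum_quadratic_eq_add_sum zetaTable w hg N hsupp, tableDatum_zetaTable_quadratic,
    multiSiteQuadratic]

/-- Every test function has a window: `∃ N ≥ N₀, supp g ⊆ [-½log(N+1), ½log(N+1)]`, for any
prescribed `N₀`. [this work] -/
theorem exists_window {g : ℝ → ℂ} (hg : IsWeilTest g) (N₀ : ℕ) :
    ∃ N : ℕ, N₀ ≤ N ∧
      tsupport g ⊆ Icc (-(Real.log ((N : ℝ) + 1) / 2)) (Real.log ((N : ℝ) + 1) / 2) := by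
  obtain ⟨a, -, ha⟩ := hg.exists_tsupport_subset_Icc
  obtain ⟨N₁, hN₁⟩ := exists_window_le_log_succ_half a
  refine ⟨max N₁ N₀, le_max_right _ _, ha.trans (Icc_subset_Icc (by linarith [hmono N₁ N₀ hN₁])
    (hmono N₁ N₀ hN₁))⟩
  where
  /-- monotonicity of the window in `N` -/
  hmono (N₁ N₀ : ℕ) {a : ℝ} (h : a ≤ Real.log ((N₁ : ℝ) + 1) / 2) :
      a ≤ Real.log (((max N₁ N₀ : ℕ) : ℝ) + 1) / 2 := by
    refine h.trans ?_
    have : (N₁ : ℝ) ≤ ((max N₁ N₀ : ℕ) : ℝ) := by exact_mod_cast le_max_left _ _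
    gcongr

/-- **A priori bound**: `Re Q_w(g) ≤ Re W(g ⋆ g̃) + 2(∑_n |Λ(n)/√n - w(n)|) ‖g‖₂²`. [this work] -/
theorem table_re_le {w : ℕ → ℝ} (hsum : Summable fun n ↦ |zetaTable n - w n|) {g : ℝ → ℂ}
    (hg : IsWeilTest g) :
    ((tableDatum w).quadratic g).re ≤
      (weilQuadratic g).re + 2 * (∑' n, |zetaTable n - w n|) * ∫ u, ‖g u‖ ^ 2 := by
  obtain ⟨N, -, hsupp⟩ := exists_window hg 0
  rw [tableDatum_quadratic_eq_multiSite_range w hg hsupp]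
  have h1 := multiSiteQuadratic_re_le (Finset.range (N + 1)) (fun n ↦ zetaTable n - w n)
    (fun n : ℕ ↦ Real.log (n : ℝ)) hg
  have h2 : ∑ n ∈ Finset.range (N + 1), |zetaTable n - w n| ≤ ∑' n, |zetaTable n - w n| :=
    hsum.sum_le_tsum _ fun _ _ ↦ abs_nonneg _
  have h3 : (0 : ℝ) ≤ ∫ u, ‖g u‖ ^ 2 := integral_nonneg fun u ↦ by positivity
  nlinarith

/-- **(RH-free)** A uniform lower bound `B‖g‖₂² ≤ Re Q_w(g)` on the test class forces RH.
[this work] -/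
theorem riemannHypothesis_of_table_lower_bound {w : ℕ → ℝ}
    (hsum : Summable fun n ↦ |zetaTable n - w n|) {B : ℝ}
    (hB : ∀ g : ℝ → ℂ, IsWeilTest g → 0 < ∫ u, ‖g u‖ ^ 2 →
      B * ∫ u, ‖g u‖ ^ 2 ≤ ((tableDatum w).quadratic g).re) :
    RiemannHypothesis := by
  by_contra hRH
  obtain ⟨a, -, -, g, hg, -, hnorm, hW⟩ :=
    exists_weilQuadratic_lt_of_not_riemannHypothesis hRH (|B| + 2 * ∑' n, |zetaTable n - w n|) 0
  have h1 := hB g hg (by rw [hnorm]; exact one_pos)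
  have h2 := table_re_le hsum hg
  rw [hnorm] at h1 h2
  linarith [neg_abs_le B]

/-! ## §49 The wave-packet site-sum estimate with a general symbol level -/

/-- For the wave packet `g_{R,t₀}` and sites `log n`, `n ≤ N`, with a tail cut at `N₁ ≤ N`:
`∑_{n ≤ N} 2c(n) cos(t₀ log n) I_R(log n) ≤ 2 I_R(0) μ + 4K ∑_{n ≤ N₁} |c(n)||log n| + 8Rη`
whenever `P_{N+1}(t₀) ≤ μ` and `∑_{N₁ < n ≤ N} |c(n)| ≤ η` (`I_R` = the overlap of part IV-b,
`K` a Lipschitz constant of the plateau). [this work] -/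
theorem siteSum_range_wavePacket_le {c : ℕ → ℝ} {R : ℝ} (hR0 : 0 < R) (t₀ : ℝ) {K : ℝ≥0}
    (hK : LipschitzWith K (plateau : ℝ → ℝ)) {N₁ N : ℕ} (hN : N₁ ≤ N) {μ η : ℝ}
    (hP : siteSymbol (Finset.range (N + 1)) c (fun n : ℕ ↦ Real.log (n : ℝ)) t₀ ≤ μ)
    (hη : ∑ n ∈ Finset.Ico (N₁ + 1) (N + 1), |c n| ≤ η) :
    ∑ n ∈ Finset.range (N + 1),
        2 * c n * (Real.cos (t₀ * Real.log (n : ℝ)) * overlap R (Real.log (n : ℝ))) ≤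
      2 * overlap R 0 * μ + 4 * K * (∑ n ∈ Finset.range (N₁ + 1), |c n| * |Real.log (n : ℝ)|) +
        8 * R * η := by
  have hK0 : (0 : ℝ) ≤ K := K.2
  have hsplit : ∑ n ∈ Finset.range (N + 1),
      2 * c n * (Real.cos (t₀ * Real.log (n : ℝ)) * overlap R (Real.log (n : ℝ))) =
      2 * overlap R 0 * siteSymbol (Finset.range (N + 1)) c (fun n : ℕ ↦ Real.log (n : ℝ)) t₀ +
        2 * ∑ n ∈ Finset.range (N + 1), c n * Real.cos (t₀ * Real.log (n : ℝ)) *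
          (overlap R (Real.log (n : ℝ)) - overlap R 0) := by
    rw [siteSymbol, Finset.mul_sum, Finset.mul_sum, ← Finset.sum_add_distrib]
    exact Finset.sum_congr rfl fun n _ ↦ by ring
  have hO0 : 0 ≤ overlap R 0 := overlap_nonneg R 0
  have hmain : 2 * overlap R 0 *
      siteSymbol (Finset.range (N + 1)) c (fun n : ℕ ↦ Real.log (n : ℝ)) t₀ ≤
        2 * overlap R 0 * μ := mul_le_mul_of_nonneg_left hP (by linarith)
  -- the error sum, split at `N₁`
  have hnear : ∑ n ∈ Finset.range (N₁ + 1), c n * Real.cos (t₀ * Real.log (n : ℝ)) *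
      (overlap R (Real.log (n : ℝ)) - overlap R 0) ≤
        2 * K * ∑ n ∈ Finset.range (N₁ + 1), |c n| * |Real.log (n : ℝ)| := by
    rw [Finset.mul_sum]
    refine Finset.sum_le_sum fun n _ ↦ ?_
    have h1 : |overlap R (Real.log (n : ℝ)) - overlap R 0| ≤ 2 * (K : ℝ) * |Real.log (n : ℝ)| :=
      abs_overlap_sub_overlap_zero_le hR0 hK _
    have h2 := abs_mul_cos_log_le c t₀ n
    calc c n * Real.cos (t₀ * Real.log (n : ℝ)) * (overlap R (Real.log (n : ℝ)) - overlap R 0)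
        ≤ |c n * Real.cos (t₀ * Real.log (n : ℝ)) * (overlap R (Real.log (n : ℝ)) - overlap R 0)| :=
          le_abs_self _
      _ = |c n * Real.cos (t₀ * Real.log (n : ℝ))| * |overlap R (Real.log (n : ℝ)) - overlap R 0| :=
          abs_mul _ _
      _ ≤ |c n| * (2 * (K : ℝ) * |Real.log (n : ℝ)|) :=
          mul_le_mul h2 h1 (abs_nonneg _) (abs_nonneg _)
      _ = 2 * K * (|c n| * |Real.log (n : ℝ)|) := by ring
  have hfar : ∑ n ∈ Finset.Ico (N₁ + 1) (N + 1), c n * Real.cos (t₀ * Real.log (n : ℝ)) *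
      (overlap R (Real.log (n : ℝ)) - overlap R 0) ≤ 4 * R * η := by
    have h4R : 0 ≤ 4 * R := by linarith
    calc ∑ n ∈ Finset.Ico (N₁ + 1) (N + 1), c n * Real.cos (t₀ * Real.log (n : ℝ)) *
          (overlap R (Real.log (n : ℝ)) - overlap R 0)
        ≤ ∑ n ∈ Finset.Ico (N₁ + 1) (N + 1), |c n| * (4 * R) := by
          refine Finset.sum_le_sum fun n _ ↦ ?_
          have h1 : |overlap R (Real.log (n : ℝ)) - overlap R 0| ≤ 4 * R :=
            abs_overlap_sub_overlap_zero_le_four_mul hR0 _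
          have h2 := abs_mul_cos_log_le c t₀ n
          calc c n * Real.cos (t₀ * Real.log (n : ℝ)) *
                (overlap R (Real.log (n : ℝ)) - overlap R 0)
              ≤ |c n * Real.cos (t₀ * Real.log (n : ℝ)) *
                  (overlap R (Real.log (n : ℝ)) - overlap R 0)| := le_abs_self _
            _ = |c n * Real.cos (t₀ * Real.log (n : ℝ))| *
                  |overlap R (Real.log (n : ℝ)) - overlap R 0| := abs_mul _ _
            _ ≤ |c n| * (4 * R) := mul_le_mul h2 h1 (abs_nonneg _) (abs_nonneg _)
      _ = 4 * R * ∑ n ∈ Finset.Ico (N₁ + 1) (N + 1), |c n| := by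
          rw [Finset.mul_sum]
          exact Finset.sum_congr rfl fun n _ ↦ by ring
      _ ≤ 4 * R * η := mul_le_mul_of_nonneg_left hη h4R
  have hsplit2 : ∑ n ∈ Finset.range (N + 1), c n * Real.cos (t₀ * Real.log (n : ℝ)) *
      (overlap R (Real.log (n : ℝ)) - overlap R 0) =
      ∑ n ∈ Finset.range (N₁ + 1), c n * Real.cos (t₀ * Real.log (n : ℝ)) *
          (overlap R (Real.log (n : ℝ)) - overlap R 0) +
        ∑ n ∈ Finset.Ico (N₁ + 1) (N + 1), c n * Real.cos (t₀ * Real.log (n : ℝ)) *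
          (overlap R (Real.log (n : ℝ)) - overlap R 0) := by
    rw [Finset.range_eq_Ico, Finset.range_eq_Ico,
      Finset.sum_Ico_consecutive _ (Nat.zero_le _) (by omega : N₁ + 1 ≤ N + 1)]
  rw [hsplit, hsplit2]
  linarith

/-! ## §50 The Plancherel lower bound for `ℓ¹` tables (RH-free) -/

/-- **(RH-free)** `Re W(g ⋆ g̃) + 2 (inf_t P(t)) ‖g‖₂² ≤ Re Q_w(g)` for every test function `g`,
where `P` is the symbol of `c = Λ/√· - w`. [this work] -/
theorem table_re_ge {w : ℕ → ℝ} (hsum : Summable fun n ↦ |zetaTable n - w n|) {g : ℝ → ℂ}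
    (hg : IsWeilTest g) :
    (weilQuadratic g).re + 2 * (⨅ t, tableSymbol (fun n ↦ zetaTable n - w n) t) * ∫ u, ‖g u‖ ^ 2 ≤
      ((tableDatum w).quadratic g).re := by
  set c : ℕ → ℝ := fun n ↦ zetaTable n - w n with hc
  have hm0 : (0 : ℝ) ≤ ∫ u, ‖g u‖ ^ 2 := integral_nonneg fun u ↦ by positivity
  -- for every admissible window the bound holds up to the tail
  have hwin : ∀ N : ℕ,
      tsupport g ⊆ Icc (-(Real.log ((N : ℝ) + 1) / 2)) (Real.log ((N : ℝ) + 1) / 2) →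
      (weilQuadratic g).re + 2 * ((⨅ t, tableSymbol c t) - absTail c (N + 1)) * ∫ u, ‖g u‖ ^ 2 ≤
        ((tableDatum w).quadratic g).re := by
    intro N hsupp
    rw [tableDatum_quadratic_eq_multiSite_range w hg hsupp]
    refine multiSiteQuadratic_re_ge_of_le_siteSymbol hg fun t ↦ ?_
    have h1 := abs_tableSymbol_sub_siteSymbol_le hsum (N + 1) t
    have h2 := ciInf_tableSymbol_le hsum t
    rw [abs_le] at h1
    linarith [h1.2]
  by_contra h
  push Not at h
  set gap := (weilQuadratic g).re + 2 * (⨅ t, tableSymbol c t) * (∫ u, ‖g u‖ ^ 2) -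
    ((tableDatum w).quadratic g).re with hgap
  have hgap0 : 0 < gap := by rw [hgap]; linarith
  obtain ⟨N₁, -, hN₁⟩ := exists_absTail_lt c (η := gap / (2 * (∫ u, ‖g u‖ ^ 2) + 1))
    (by positivity)
  obtain ⟨N, hNN₁, hsupp⟩ := exists_window hg N₁
  have h1 := hwin N hsupp
  have h2 := hN₁ (N + 1) (by omega)
  have h3 : absTail c (N + 1) * (2 * (∫ u, ‖g u‖ ^ 2) + 1) < gap := by
    rwa [lt_div_iff₀ (by positivity)] at h2
  have h4 := absTail_nonneg c (N + 1)
  nlinarith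

end Summit.RiemannHypothesis.RiemannHypothesis.Theorems.PfPersistenceCoefficientRigidity

end
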